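/-
Copyright (c) 2026. All rights reserved.
Released under Apache 2.0 license as described in the file LICENSE.
Authors: abc-iut cell, seat abc-iut-L6-t6 (bridge for abc-iut-L6-t4's `GlobalFrobenioidModels.lean`, Ex. 3.6 (i)).
-/
import Literature.IUT.LogThetaLattice.GlobalFrobenioidModelsFrobenioid
import HarnessLib

/-!
# [IUTchIII] Example 3.6 (i), (iii): the category `𝓕⊛_MOD` and its Frobenioid structure

S. Mochizuki, *Inter-universal Teichmüller Theory III*, kurims manuscript (May 2020), Example 3.6 (i)
p. 107 and (iii) p. 108 [claim key Mochizuki2012, status disputed (D-0012)]. (i): "A morphism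
`𝓣₁ → 𝓣₂` … is defined to consist of a positive integer `n` and an elementary morphism `(𝓣₁)^{⊗n} → 𝓣₂`.
… Thus, `𝓕⊛_MOD` forms a category. In fact, one verifies immediately that … `𝓕⊛_MOD` admits a natural
Frobenioid structure …, for which the base category is the category with precisely one arrow …
the elementary morphisms are precisely the linear morphisms, and the positive integer '`n`' … is the
Frobenius degree" (p. 107 l. 15–23). (iii): "a natural isomorphism of Frobenioids
`𝓕⊛_𝔪𝔬𝔡 ⥲ 𝓕⊛_MOD` that induces the identity morphism `F^×_mod → F^×_mod` on the associated rational
function monoids" (p. 108 l. 18–20).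

abc-iut-L6-t4 typed the objects `MODObj` (torsor `T` with local trivializations `t_v`), the elementary
morphisms `ElemHom`, and `Hom` over an ABSTRACT tensor-power operation. HERE the category is CONSTRUCTED
without choosing tensor powers, using the universal property of the pushed-out torsor: an elementary
morphism `𝓣₁^{⊗n} → 𝓣₂` of `F^×_mod`-torsors is the same thing as a map `φ : T₁ → T₂` that is
EQUIVARIANT ALONG `n` (`φ(g + x) = n·g + φ(x)`), integral in the sense `t_{2,v}(φ x) − n·t_{1,v}(x) ≥ 0`
(`MODCat`, morphisms `MODHom`; for `n = 1` these are exactly abc-iut-L6-t4's `ElemHom`,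
`MODHom.ofElemHom`). Then:
* `toFrak : 𝓕⊛_MOD ⥤ 𝓕⊛_𝔪𝔬𝔡`, `𝓣 ↦ {[t_v(t)]^{-1}}` for the witness `t ∈ T` of condition (b) (abc-iut-L6-t6's
  `MODObj.exists_frakObj_iso`), `(n, φ) ↦ (n, φ(t₁) − t₂)`, is an EQUIVALENCE of categories (full,
  faithful, essentially surjective) — the isomorphism of (iii), which on the element `f ∈ F^×_mod` of a
  morphism is the identity;
* hence (`GlobalFrobenioidModelsFrobenioid.lean` + `FrobenioidEquivalence.lean`) the structure
  `𝓕⊛_MOD → 𝓕⊛_𝔪𝔬𝔡 → F_Φ` is a FROBENIOID over the one-arrow base with Frobenius degree `n`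
  (`isFrobenioid_MOD`, `degFr_MOD`), of isotropic type.
Nothing here takes a side on [IUTchIII] Cor. 3.12; typed ≠ endorsed.
-/

noncomputable section

namespace Literature.IUT.LogThetaLattice

namespace GlobalFrobenioidModels

open CategoryTheory Opposite Literature.AlgebraicGeometry.Frobenioids

universe u

variable {F : Type u} [Field F] {V : Type u} {Γ : V → Type u} [∀ v, AddCommGroup (Γ v)]
  {nonneg : ∀ v, AddSubmonoid (Γ v)} {β : ∀ v, Additive Fˣ →+ Γ v}

/-! ### The category `𝓕⊛_MOD` -/

variable (F V Γ) in
/-- The objects of the category `𝓕⊛_MOD`: abc-iut-L6-t4's `MODObj F V Γ β`, recorded together with the cones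
`Γ_v^{≥0}` determining integrality (Ex. 3.6 (i), p. 107). ([IUTchIII] Ex 3.6 (i) p.107) [claim: Mochizuki2012, status: disputed] -/
@[nolint unusedArguments]
def MODCat (_nonneg : ∀ v, AddSubmonoid (Γ v)) (β' : ∀ v, Additive Fˣ →+ Γ v) : Type (u + 1) :=
  MODObj F V Γ β'

namespace MODCat

/-- An object of `𝓕⊛_MOD` from a torsor with trivializations. ([IUTchIII] Ex 3.6 (i) p.107) [claim: Mochizuki2012, status: disputed] -/
abbrev of (T : MODObj F V Γ β) : MODCat F V Γ nonneg β := T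

/-- The underlying torsor datum. ([IUTchIII] Ex 3.6 (i) p.107) [claim: Mochizuki2012, status: disputed] -/
abbrev obj (X : MODCat F V Γ nonneg β) : MODObj F V Γ β := X

/-- The underlying set `T` of an object of `𝓕⊛_MOD` is an `F^×_mod`-torsor (t4's `MODObj.instTorsor`, re-exposed
for the `MODCat` synonym). ([IUTchIII] Ex 3.6 (i) p.107) [claim: Mochizuki2012, status: disputed] -/
instance instAddTorsorObj (X : MODCat F V Γ nonneg β) : AddTorsor (Additive Fˣ) X.obj.T := X.obj.instTorsor

/-- **A morphism `𝓣₁ → 𝓣₂` of `𝓕⊛_MOD`** (p. 107 l. 15): "a positive integer `n` and an elementary morphism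
`(𝓣₁)^{⊗n} → 𝓣₂`", the latter realised as a map of the underlying sets equivariant along multiplication by
`n` on `F^×_mod` (the universal property of the tensor power `𝓣₁^{⊗n} = T₁ ×^{F^×, n} F^×`) and integral at
each `v`: `t_{2,v}(φ x) − n·t_{1,v}(x) ∈ Γ_v^{≥0}`. ([IUTchIII] Ex 3.6 (i) p.107) [claim: Mochizuki2012, status: disputed] -/
@[ext] structure Hom (X Y : MODCat F V Γ nonneg β) : Type u where
  /-- the positive integer `n` -/
  deg : ℕ+
  /-- the underlying map `T₁ → T₂` of the elementary morphism `𝓣₁^{⊗n} → 𝓣₂` -/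
  toFun : X.obj.T → Y.obj.T
  /-- equivariance along `n : F^×_mod → F^×_mod` -/
  map_vadd : ∀ (g : Additive Fˣ) (x : X.obj.T), toFun (g +ᵥ x) = ((deg : ℕ) • g) +ᵥ toFun x
  /-- integrality at every `v` -/
  integral : ∀ (v : V) (x : X.obj.T), Y.obj.t v (toFun x) - ((deg : ℕ) : ℤ) • X.obj.t v x ∈ nonneg v

/-- **`𝓕⊛_MOD` is a category** ("There is an evident notion of composition of morphisms. Thus, `𝓕⊛_MOD` forms
a category", p. 107 l. 17): degrees multiply, maps compose. ([IUTchIII] Ex 3.6 (i) p.107) [claim: Mochizuki2012, status: disputed] -/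
instance : Category.{u} (MODCat F V Γ nonneg β) where
  Hom X Y := Hom X Y
  id X := ⟨1, id, fun g x => by rw [PNat.one_coe, one_smul]; rfl, fun v x => by
    rw [PNat.one_coe, Nat.cast_one, one_zsmul]
    show X.obj.t v x - X.obj.t v x ∈ nonneg v
    rw [sub_self]
    exact (nonneg v).zero_mem⟩
  comp {X Y Z} φ ψ := ⟨ψ.deg * φ.deg, ψ.toFun ∘ φ.toFun, fun g x => by
    show ψ.toFun (φ.toFun (g +ᵥ x)) = _
    rw [φ.map_vadd, ψ.map_vadd, smul_smul, PNat.mul_coe]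
    rfl, fun v x => by
    have h := (nonneg v).add_mem (ψ.integral v (φ.toFun x))
      ((nonneg v).nsmul_mem (φ.integral v x) (ψ.deg : ℕ))
    have e : Z.obj.t v (ψ.toFun (φ.toFun x)) - (((ψ.deg * φ.deg : ℕ+) : ℕ) : ℤ) • X.obj.t v x =
        Z.obj.t v (ψ.toFun (φ.toFun x)) - ((ψ.deg : ℕ) : ℤ) • Y.obj.t v (φ.toFun x) +
          (ψ.deg : ℕ) • (Y.obj.t v (φ.toFun x) - ((φ.deg : ℕ) : ℤ) • X.obj.t v x) := by
      rw [PNat.mul_coe, Nat.cast_mul, ← natCast_zsmul, smul_sub, smul_smul]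
      abel
    show Z.obj.t v (ψ.toFun (φ.toFun x)) - (((ψ.deg * φ.deg : ℕ+) : ℕ) : ℤ) • X.obj.t v x ∈ nonneg v
    rw [e]
    exact h⟩
  id_comp φ := Hom.ext (mul_one _) rfl
  comp_id φ := Hom.ext (one_mul _) rfl
  assoc φ ψ χ := Hom.ext (mul_assoc _ _ _).symm rfl

/-- The Frobenius degree `n` of a morphism of `𝓕⊛_MOD`. ([IUTchIII] Ex 3.6 (i) p.107) [claim: Mochizuki2012, status: disputed] -/
abbrev deg {X Y : MODCat F V Γ nonneg β} (φ : X ⟶ Y) : ℕ+ := Hom.deg φ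

/-- The underlying map of a morphism of `𝓕⊛_MOD`. ([IUTchIII] Ex 3.6 (i) p.107) [claim: Mochizuki2012, status: disputed] -/
abbrev app {X Y : MODCat F V Γ nonneg β} (φ : X ⟶ Y) : X.obj.T → Y.obj.T := Hom.toFun φ

/-- Extensionality. ([IUTchIII] Ex 3.6 (i) p.107) [claim: Mochizuki2012, status: disputed] -/
theorem hom_ext {X Y : MODCat F V Γ nonneg β} {φ ψ : X ⟶ Y} (h₁ : deg φ = deg ψ)
    (h₂ : app φ = app ψ) : φ = ψ :=
  Hom.ext h₁ h₂

/-- `deg (φ ≫ ψ) = deg ψ * deg φ`. ([IUTchIII] Ex 3.6 (i) p.107) [claim: Mochizuki2012, status: disputed] -/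
@[simp] theorem deg_comp {X Y Z : MODCat F V Γ nonneg β} (φ : X ⟶ Y) (ψ : Y ⟶ Z) :
    deg (φ ≫ ψ) = deg ψ * deg φ := rfl

/-- `app (φ ≫ ψ) = app ψ ∘ app φ`. ([IUTchIII] Ex 3.6 (i) p.107) [claim: Mochizuki2012, status: disputed] -/
@[simp] theorem app_comp {X Y Z : MODCat F V Γ nonneg β} (φ : X ⟶ Y) (ψ : Y ⟶ Z) (x : X.obj.T) :
    app (φ ≫ ψ) x = app ψ (app φ x) := rfl

/-- `deg (𝟙 X) = 1`. ([IUTchIII] Ex 3.6 (i) p.107) [claim: Mochizuki2012, status: disputed] -/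
@[simp] theorem deg_id (X : MODCat F V Γ nonneg β) : deg (𝟙 X) = 1 := rfl

/-- `app (𝟙 X) = id`. ([IUTchIII] Ex 3.6 (i) p.107) [claim: Mochizuki2012, status: disputed] -/
@[simp] theorem app_id (X : MODCat F V Γ nonneg β) (x : X.obj.T) : app (𝟙 X) x = x := rfl

/-- An ELEMENTARY morphism in abc-iut-L6-t4's sense (`ElemHom`: an isomorphism of torsors, integral at each
`v`) is a morphism of degree `1`. ([IUTchIII] Ex 3.6 (i) p.107) [claim: Mochizuki2012, status: disputed] -/
def Hom.ofElemHom {X Y : MODCat F V Γ nonneg β} (φ : ElemHom (nonneg := nonneg) X.obj Y.obj) : X ⟶ Y :=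
  ⟨1, φ.toEquiv, fun g x => by rw [PNat.one_coe, one_smul]; exact φ.map_vadd g x, fun v x => by
    rw [PNat.one_coe, Nat.cast_one, one_zsmul]
    exact φ.integral v x⟩

/-- `ofElemHom φ` has degree `1`. ([IUTchIII] Ex 3.6 (i) p.107) [claim: Mochizuki2012, status: disputed] -/
@[simp] theorem deg_ofElemHom {X Y : MODCat F V Γ nonneg β} (φ : ElemHom (nonneg := nonneg) X.obj Y.obj) :
    deg (Hom.ofElemHom φ) = 1 := rfl

/-- The value of a morphism is determined by its value at one point: `φ(x) = n·(x − x₀) + φ(x₀)`.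
([IUTchIII] Ex 3.6 (i) p.107) [claim: Mochizuki2012, status: disputed] -/
theorem app_eq {X Y : MODCat F V Γ nonneg β} (φ : X ⟶ Y) (x₀ x : X.obj.T) :
    app φ x = ((deg φ : ℕ) • (x -ᵥ x₀)) +ᵥ app φ x₀ := by
  conv_lhs => rw [← vsub_vadd x x₀]
  exact Hom.map_vadd φ _ _

end MODCat

/-! ### The comparison functor `𝓕⊛_MOD ⥤ 𝓕⊛_𝔪𝔬𝔡` (Example 3.6 (iii)) -/

namespace MODCat

variable (X : MODCat F V Γ nonneg β)

/-- The witness `t ∈ T` of condition (b) of Ex. 3.6 (i): `t_v(t) = 0` for almost all `v`.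
([IUTchIII] Ex 3.6 (i) p.107) [claim: Mochizuki2012, status: disputed] -/
def pt : X.obj.T := X.obj.almostAll.choose

/-- `t_v(t) = 0` for almost all `v`. ([IUTchIII] Ex 3.6 (i) p.107) [claim: Mochizuki2012, status: disputed] -/
theorem pt_finite : {v | X.obj.t v X.pt ≠ 0}.Finite := X.obj.almostAll.choose_spec

/-- The fractional-ideal family `𝔍(𝓣) := {[t_v(t)]^{-1}}_v` attached to `𝓣` (Ex. 3.6 (iii), object part of the
inverse identification; abc-iut-L6-t6's `MODObj.exists_frakObj_iso`). ([IUTchIII] Ex 3.6 (iii) p.108) [claim: Mochizuki2012, status: disputed] -/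
def frak : FrakObj V Γ where
  cls v := -X.obj.t v X.pt
  finite := X.pt_finite.subset fun v hv => by
    intro h
    exact hv (neg_eq_zero.mpr h)

/-- The classes of `𝔍(𝓣)`. ([IUTchIII] Ex 3.6 (iii) p.108) [claim: Mochizuki2012, status: disputed] -/
@[simp] theorem cls_frak (v : V) : X.frak.cls v = -X.obj.t v X.pt := rfl

variable {X}

/-- Equivariance of the trivializations: `t_v(g + x) = β_v(g) + t_v(x)`. ([IUTchIII] Ex 3.6 (i) p.107) [claim: Mochizuki2012, status: disputed] -/
theorem t_vadd (v : V) (g : Additive Fˣ) (x : X.obj.T) : X.obj.t v (g +ᵥ x) = β v g + X.obj.t v x :=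
  X.obj.equivariant v g x

/-- `t_v(y) = β_v(y − x) + t_v(x)`. ([IUTchIII] Ex 3.6 (i) p.107) [claim: Mochizuki2012, status: disputed] -/
theorem t_eq (v : V) (x y : X.obj.T) : X.obj.t v y = β v (y -ᵥ x) + X.obj.t v x := by
  rw [← t_vadd (β := β), vsub_vadd]

end MODCat

/-- The element of `F^×_mod` underlying a morphism `(n, φ) : 𝓣₁ → 𝓣₂`: `φ(t₁) − t₂` (additively).
([IUTchIII] Ex 3.6 (iii) p.108) [claim: Mochizuki2012, status: disputed] -/
def MODCat.fnOf {X Y : MODCat F V Γ nonneg β} (φ : X ⟶ Y) : Fˣ :=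
  Additive.toMul (MODCat.app φ X.pt -ᵥ Y.pt)

/-- `(n, φ(t₁) − t₂)` is a morphism `𝔍(𝓣₁) → 𝔍(𝓣₂)` of `𝓕⊛_𝔪𝔬𝔡`: its integrality is the integrality of `φ` at
`t₁`. ([IUTchIII] Ex 3.6 (iii) p.108) [claim: Mochizuki2012, status: disputed] -/
theorem MODCat.isHom_fnOf {X Y : MODCat F V Γ nonneg β} (φ : X ⟶ Y) :
    FrakObj.IsHom (nonneg := nonneg) (β := β) X.frak Y.frak (MODCat.deg φ) (MODCat.fnOf φ) := by
  intro v
  have hint := MODCat.Hom.integral φ v X.pt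
  have e : β v (Additive.ofMul (MODCat.fnOf φ)) = Y.obj.t v (MODCat.app φ X.pt) - Y.obj.t v Y.pt := by
    rw [show MODCat.fnOf φ = Additive.toMul (MODCat.app φ X.pt -ᵥ Y.pt) from rfl, ofMul_toMul,
      MODCat.t_eq (β := β) v Y.pt (MODCat.app φ X.pt), add_sub_cancel_right]
  show β v (Additive.ofMul (MODCat.fnOf φ)) + ((MODCat.deg φ : ℕ) : ℤ) • (-X.obj.t v X.pt) -
    (-Y.obj.t v Y.pt) ∈ nonneg v
  rw [e, smul_neg]
  convert hint using 1
  abel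

/-- **The comparison functor `𝓕⊛_MOD ⥤ 𝓕⊛_𝔪𝔬𝔡`** (inverse direction of the "natural isomorphism of Frobenioids
`𝓕⊛_𝔪𝔬𝔡 ⥲ 𝓕⊛_MOD`" of (iii)): `𝓣 ↦ 𝔍(𝓣)`, `(n, φ) ↦ (n, φ(t₁) − t₂)`. ([IUTchIII] Ex 3.6 (iii) p.108) [claim: Mochizuki2012, status: disputed] -/
def toFrak : MODCat F V Γ nonneg β ⥤ FrakCat F V Γ nonneg β where
  obj X := FrakCat.of X.frak
  map φ := FrakCat.homMk (MODCat.deg φ) (MODCat.fnOf φ) (MODCat.isHom_fnOf φ)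
  map_id X := FrakCat.hom_ext rfl (by
    show Additive.toMul (X.pt -ᵥ X.pt) = 1
    rw [vsub_self, toMul_zero])
  map_comp {X Y Z} φ ψ := FrakCat.hom_ext rfl (by
    show Additive.toMul (MODCat.app ψ (MODCat.app φ X.pt) -ᵥ Z.pt) =
      Additive.toMul (MODCat.app ψ Y.pt -ᵥ Z.pt) *
        Additive.toMul (MODCat.app φ X.pt -ᵥ Y.pt) ^ (MODCat.deg ψ : ℕ)
    rw [(MODCat.app_eq ψ Y.pt (MODCat.app φ X.pt)), vadd_vsub_assoc, toMul_add, toMul_nsmul, mul_comm])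

/-- `toFrak` preserves Frobenius degrees. ([IUTchIII] Ex 3.6 (iii) p.108) [claim: Mochizuki2012, status: disputed] -/
@[simp] theorem deg_toFrak_map {X Y : MODCat F V Γ nonneg β} (φ : X ⟶ Y) :
    FrakCat.deg (toFrak.map φ) = MODCat.deg φ := rfl

/-- `toFrak` on the element of a morphism. ([IUTchIII] Ex 3.6 (iii) p.108) [claim: Mochizuki2012, status: disputed] -/
theorem fn_toFrak_map {X Y : MODCat F V Γ nonneg β} (φ : X ⟶ Y) :
    FrakCat.fn (toFrak.map φ) = MODCat.fnOf φ := rfl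

/-- `toFrak` is FAITHFUL: `(n, φ)` is recovered from `(n, φ(t₁) − t₂)` since `φ(x) = n(x − t₁) + φ(t₁)`.
([IUTchIII] Ex 3.6 (iii) p.108) [claim: Mochizuki2012, status: disputed] -/
theorem toFrak_faithful : (toFrak : MODCat F V Γ nonneg β ⥤ FrakCat F V Γ nonneg β).Faithful where
  map_injective {X Y} := fun φ ψ h => by
    have hdeg : MODCat.deg φ = MODCat.deg ψ := congrArg FrakCat.Hom.deg h
    have hfn : MODCat.app φ X.pt -ᵥ Y.pt = MODCat.app ψ X.pt -ᵥ Y.pt :=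
      Additive.toMul.injective (congrArg FrakCat.Hom.fn h)
    refine MODCat.hom_ext hdeg (funext fun x => ?_)
    rw [(MODCat.app_eq φ X.pt x), MODCat.app_eq ψ X.pt x, hdeg, ← vsub_vadd (MODCat.app φ X.pt) Y.pt,
      ← vsub_vadd (MODCat.app ψ X.pt) Y.pt, hfn]

/-- The morphism `𝓣₁ → 𝓣₂` with prescribed degree `n` and element `f`: `x ↦ (n·(x − t₁) + f) + t₂`.
([IUTchIII] Ex 3.6 (iii) p.108) [claim: Mochizuki2012, status: disputed] -/
def MODCat.homOf {X Y : MODCat F V Γ nonneg β} (n : ℕ+) (f : Fˣ)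
    (h : FrakObj.IsHom (nonneg := nonneg) (β := β) X.frak Y.frak n f) : X ⟶ Y :=
  ⟨n, fun x => ((n : ℕ) • (x -ᵥ X.pt) + Additive.ofMul f) +ᵥ Y.pt, fun g x => by
    show (((n : ℕ) • ((g +ᵥ x) -ᵥ X.pt) + Additive.ofMul f) +ᵥ Y.pt) =
      ((n : ℕ) • g) +ᵥ ((((n : ℕ) • (x -ᵥ X.pt) + Additive.ofMul f) +ᵥ Y.pt))
    rw [vadd_vsub_assoc, nsmul_add, vadd_vadd, add_assoc], fun v x => by
    have hx := MODCat.t_eq (β := β) v X.pt x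
    have hv : β v (Additive.ofMul f) + ((n : ℕ) : ℤ) • (-X.obj.t v X.pt) - (-Y.obj.t v Y.pt) ∈ nonneg v :=
      h v
    rw [smul_neg] at hv
    show Y.obj.t v ((((n : ℕ) • (x -ᵥ X.pt) + Additive.ofMul f) +ᵥ Y.pt)) - ((n : ℕ) : ℤ) • X.obj.t v x ∈
      nonneg v
    rw [(MODCat.t_vadd (β := β)), hx, map_add, map_nsmul, smul_add, ← natCast_zsmul]
    convert hv using 1
    abel⟩

/-- `toFrak` is FULL: `(n, f) : 𝔍(𝓣₁) → 𝔍(𝓣₂)` is the image of `homOf n f`. ([IUTchIII] Ex 3.6 (iii) p.108) [claim: Mochizuki2012, status: disputed] -/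
theorem toFrak_full : (toFrak : MODCat F V Γ nonneg β ⥤ FrakCat F V Γ nonneg β).Full where
  map_surjective {X Y} ψ :=
    ⟨MODCat.homOf (FrakCat.deg ψ) (FrakCat.fn ψ) (FrakCat.Hom.isHom ψ), FrakCat.hom_ext rfl (by
      show Additive.toMul ((((FrakCat.deg ψ : ℕ) • (X.pt -ᵥ X.pt) + Additive.ofMul (FrakCat.fn ψ)) +ᵥ Y.pt)
        -ᵥ Y.pt) = FrakCat.fn ψ
      rw [vsub_self, smul_zero, zero_add, vadd_vsub, toMul_ofMul])⟩

/-- `toFrak` is ESSENTIALLY SURJECTIVE: `𝔍` is isomorphic in `𝓕⊛_𝔪𝔬𝔡` to `𝔍(𝔍.toMOD)` (they differ by the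
principal family of the chosen witness). ([IUTchIII] Ex 3.6 (iii) p.108) [claim: Mochizuki2012, status: disputed] -/
theorem toFrak_essSurj : (toFrak : MODCat F V Γ nonneg β ⥤ FrakCat F V Γ nonneg β).EssSurj where
  mem_essImage J := by
    let X : MODCat F V Γ nonneg β := MODCat.of (FrakObj.toMOD (F := F) (β := β) J.obj)
    -- the witness `x₀ ∈ F^×` chosen for `J.toMOD`; `𝔍(J.toMOD)_v = J_v - β_v(x₀)`
    let x₀ : Additive Fˣ := X.pt
    have hcls : ∀ v, X.frak.cls v = J.obj.cls v - β v x₀ := fun v => by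
      rw [(MODCat.cls_frak)]
      show -(β v x₀ - J.obj.cls v) = _
      rw [neg_sub]
    have h1 : FrakObj.IsHom (nonneg := nonneg) (β := β) X.frak J.obj 1 (Additive.toMul x₀) := by
      refine (FrakObj.isHom_one_iff _ _ _).mpr fun v => ?_
      rw [ofMul_toMul, hcls]
      have : β v x₀ + (J.obj.cls v - β v x₀) - J.obj.cls v = 0 := by abel
      rw [this]
      exact (nonneg v).zero_mem
    have h2 : FrakObj.IsHom (nonneg := nonneg) (β := β) J.obj X.frak 1 (Additive.toMul (-x₀)) := by
      refine (FrakObj.isHom_one_iff _ _ _).mpr fun v => ?_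
      rw [ofMul_toMul, hcls, map_neg]
      have : -β v x₀ + J.obj.cls v - (J.obj.cls v - β v x₀) = 0 := by abel
      rw [this]
      exact (nonneg v).zero_mem
    refine ⟨X, ⟨⟨FrakCat.homMk 1 _ h1, FrakCat.homMk 1 _ h2, ?_, ?_⟩⟩⟩
    · exact FrakCat.hom_ext rfl (by
        show Additive.toMul (-x₀) * Additive.toMul x₀ ^ ((1 : ℕ+) : ℕ) = 1
        rw [PNat.one_coe, pow_one, ← toMul_add, neg_add_cancel, toMul_zero])
    · exact FrakCat.hom_ext rfl (by
        show Additive.toMul x₀ * Additive.toMul (-x₀) ^ ((1 : ℕ+) : ℕ) = 1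
        rw [PNat.one_coe, pow_one, ← toMul_add, add_neg_cancel, toMul_zero])

/-- **`𝓕⊛_MOD ≌ 𝓕⊛_𝔪𝔬𝔡`** (the isomorphism of (iii) as an equivalence of categories): `toFrak` is an equivalence.
([IUTchIII] Ex 3.6 (iii) p.108) [claim: Mochizuki2012, status: disputed] -/
instance toFrak_isEquivalence : (toFrak : MODCat F V Γ nonneg β ⥤ FrakCat F V Γ nonneg β).IsEquivalence :=
  haveI := toFrak_full (F := F) (V := V) (Γ := Γ) (nonneg := nonneg) (β := β)
  haveI := toFrak_faithful (F := F) (V := V) (Γ := Γ) (nonneg := nonneg) (β := β)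
  haveI := toFrak_essSurj (F := F) (V := V) (Γ := Γ) (nonneg := nonneg) (β := β)
  { }

/-! ### The Frobenioid structure of `𝓕⊛_MOD` (Example 3.6 (i)) -/

section Hyps

variable (H : ModelHyps nonneg β)

/-- **The natural Frobenioid structure of `𝓕⊛_MOD`** (p. 107 l. 18–21): `𝓕⊛_MOD → 𝓕⊛_𝔪𝔬𝔡 → F_Φ` over the
one-arrow base. ([IUTchIII] Ex 3.6 (i) p.107) [claim: Mochizuki2012, status: disputed] -/
def structureFunctorMOD : MODCat F V Γ nonneg β ⥤ ElemFrobenioid (Φmod V Γ nonneg) :=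
  toFrak ⋙ structureFunctor H

/-- "the positive integer '`n`' … is the Frobenius degree of the morphism" (p. 107 l. 22–23).
([IUTchIII] Ex 3.6 (i) p.107) [claim: Mochizuki2012, status: disputed] -/
theorem degFr_MOD {X Y : MODCat F V Γ nonneg β} (φ : X ⟶ Y) :
    PreFrobenioid.degFr (structureFunctorMOD H) φ = MODCat.deg φ := rfl

/-- "the elementary morphisms are precisely the linear morphisms" (p. 107 l. 21–22): linear iff `n = 1`;
in particular abc-iut-L6-t4's elementary morphisms `ElemHom` are linear. ([IUTchIII] Ex 3.6 (i) p.107) [claim: Mochizuki2012, status: disputed] -/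
theorem isLinear_MOD_iff {X Y : MODCat F V Γ nonneg β} (φ : X ⟶ Y) :
    PreFrobenioid.IsLinear (structureFunctorMOD H) φ ↔ MODCat.deg φ = 1 := Iff.rfl

/-- An `ElemHom` is a linear morphism of the Frobenioid `𝓕⊛_MOD`. ([IUTchIII] Ex 3.6 (i) p.107) [claim: Mochizuki2012, status: disputed] -/
theorem isLinear_ofElemHom {X Y : MODCat F V Γ nonneg β} (φ : ElemHom (nonneg := nonneg) X.obj Y.obj) :
    PreFrobenioid.IsLinear (structureFunctorMOD H) (MODCat.Hom.ofElemHom φ) := rfl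

/-- "for which the base category is the category with precisely one arrow" (p. 107 l. 20–21).
([IUTchIII] Ex 3.6 (i) p.107) [claim: Mochizuki2012, status: disputed] -/
theorem baseObj_MOD (X : MODCat F V Γ nonneg β) : PreFrobenioid.baseObj (structureFunctorMOD H) X = pt := rfl

/-- **`𝓕⊛_MOD` "admits a natural Frobenioid structure [cf. [FrdI], Definition 1.3]"** (p. 107 l. 18–20) —
VERIFIED: the structure functor satisfies abc-iut-found's `PreFrobenioid.IsFrobenioid` (Def. 1.3 (i)–(vii)),
by transport of `GlobalFrobenioidModels.isFrobenioid` along the equivalence `toFrak`.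
([IUTchIII] Ex 3.6 (i) p.107) [claim: Mochizuki2012, status: disputed] -/
theorem isFrobenioid_MOD : PreFrobenioid.IsFrobenioid (structureFunctorMOD H) :=
  PreFrobenioid.IsFrobenioid.comp_of_isEquivalence toFrak (isFrobenioid H)

/-- `𝓕⊛_MOD` is of isotropic type. ([IUTchIII] Ex 3.6 (i) p.107) [claim: Mochizuki2012, status: disputed] -/
theorem isOfIsotropicType_MOD : PreFrobenioid.IsOfIsotropicType (structureFunctorMOD H) :=
  PreFrobenioid.isOfIsotropicType_comp_equivalence
    (toFrak : MODCat F V Γ nonneg β ⥤ FrakCat F V Γ nonneg β).asEquivalence (isOfIsotropicType H)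

end Hyps

end GlobalFrobenioidModels

end Literature.IUT.LogThetaLattice
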